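import Literature.NumberTheory.GaloisCohomology.CorrectionAtPOfCharacter
import Literature.NumberTheory.GaloisCohomology.CyclotomicCharacterSupply
import Literature.NumberTheory.GaloisCohomology.PoitouTateTotallyComplex
import HarnessLib

/-!
# The reciprocity law `∑_v inv_v = 0` on `H²(Γ_K, μ_n)` for totally complex number fields

Tate's theorem (Cassels–Fröhlich VII §11 / §9.6) in the tree's Poitou–Tate dialect
`poitouTate_sum_localTatePairing_eq_zero K` (for every `n ≥ 1` a perfect family of local invariant
maps on `H²(Γ_{K_v}, μ_n)` along which the invariants of every global class sum to zero), for `K`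
totally complex.  This file is the last assembly step of the (F1) campaign of `pub/bsd-cn100`:

* `exists_correction_trivial_above_p` — Tate's correction above `p` (the pre-reduction): the
  hypothesis `hpre` of `poitouTate_sum_localTatePairing_eq_zero_of_isTotallyComplex_of_correction`
  (`PoitouTateTotallyComplex.lean`), obtained by feeding the auxiliary cyclotomic character
  (`exists_cyclicCharacter_correctionSupply`, `CyclotomicCharacterSupply.lean`) to the correction
  assembly `correction_of_characterSupply` (`CorrectionAtPOfCharacter.lean`);
* `poitouTate_sum_localTatePairing_eq_zero_of_isTotallyComplex` — the reciprocity law.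

Upstream (all in the tree): local evaluation of invariants on cyclic classes
(`LocalInvariantMapEvaluation`), the cyclic reciprocity law from Artin reciprocity
(`BrauerSumInvCyclicClass`), cyclic surjectivity (`CyclicClassOfResEqZero`), killing in the
cyclotomic `ℤ_p`-tower (`CyclotomicTowerMuKilling`, `CyclotomicKillingPrimePower`), level change
(`LocalInvariantMapLevelChange`, `PoitouTatePrimaryReduction`), archimedean invariants
(`ArchimedeanInvariantMap`).  Theorems only; no named fact (D-0026).

## References

* J. Tate, *Global class field theory*, Ch. VII of Cassels–Fröhlich (1967), §9.6, §10.5, §11. [CasselsFrohlichANT1967]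
* J. Neukirch, A. Schmidt, K. Wingberg, *Cohomology of Number Fields* (2008), (8.1.16)–(8.1.17). [NSW2008]
-/

noncomputable section

open CategoryTheory Function Field NumberField IsDedekindDomain
open scoped NumberField

namespace Literature.NumberTheory.GaloisCohomology

open _root_.ContinuousCohomology
open Literature.NumberTheory.GaloisRepresentations
open Literature.NumberTheory.GaloisRepresentations.DiscreteGaloisModule

variable (K : Type) [Field K] [NumberField K] [IsTotallyComplex K] (p : ℕ) [hp : Fact p.Prime]

/-- **Tate's correction above `p`** (Cassels–Fröhlich VII §10.5 Step 3 / §11, the pre-reduction): a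
class `y ∈ H²(Γ_K, μ_{p^{m+1}})` of the totally complex number field `K` with local invariants
supported in the finite set `S` can be raised to a level `p^e`, `e ≥ m+1`, and corrected by a cyclic
class so that the corrected class `y'` VANISHES AT EVERY PLACE ABOVE `p`, has invariants supported in
a finite `S' ⊇ S`, and `∑_{v ∈ T} inv_v(y') = p^{e-m-1} · ∑_{v ∈ T} inv_v(y)` for all finite `T ⊇ S'`
— the hypothesis `hpre` of `poitouTate_sum_localTatePairing_eq_zero_of_isTotallyComplex_of_correction`,
discharged: `correction_of_characterSupply` fed with `exists_cyclicCharacter_correctionSupply`.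
[cite: CasselsFrohlichANT1967, Ch. VII §11] -/
theorem exists_correction_trivial_above_p (m : ℕ)
    (y : galoisCohomology (mu K (p ^ (m + 1))) 2) (S : Finset (HeightOneSpectrum (𝓞 K)))
    (hS : ∀ v ∉ S, localInvariantMap K (p ^ (m + 1)) v
      (galoisCohomology.localization (mu K (p ^ (m + 1))) (Sum.inr v) 2 y) = 0) :
    ∃ e : ℕ, m + 1 ≤ e ∧ ∃ (y' : galoisCohomology (mu K (p ^ e)) 2) (S' : Finset (HeightOneSpectrum (𝓞 K))),
      S ⊆ S' ∧
      (∀ v : HeightOneSpectrum (𝓞 K), (p : 𝓞 K) ∈ v.asIdeal →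
        galoisCohomology.localization (mu K (p ^ e)) (Sum.inr v) 2 y' = 0) ∧
      (∀ v ∉ S', localInvariantMap K (p ^ e) v
        (galoisCohomology.localization (mu K (p ^ e)) (Sum.inr v) 2 y') = 0) ∧
      (∀ T : Finset (HeightOneSpectrum (𝓞 K)), S' ⊆ T →
        ∑ v ∈ T, localInvariantMap K (p ^ e) v (galoisCohomology.localization (mu K (p ^ e)) (Sum.inr v) 2 y') =
          (((∑ v ∈ T, localInvariantMap K (p ^ (m + 1)) v
            (galoisCohomology.localization (mu K (p ^ (m + 1))) (Sum.inr v) 2 y)).val * p ^ (e - m - 1) : ℕ) :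
            ZMod (p ^ e))) :=
  correction_of_characterSupply K p m (exists_cyclicCharacter_correctionSupply p m) y S hS

omit hp in
/-- **The reciprocity law `∑_v inv_v = 0` for totally complex number fields** (Tate's theorem,
Cassels–Fröhlich VII §9.6 / §11; Neukirch–Schmidt–Wingberg (8.1.16)–(8.1.17)), in the tree's
Poitou–Tate dialect `poitouTate_sum_localTatePairing_eq_zero`: for every `n ≥ 1` the canonical family
of local invariant maps of the totally complex number field `K` is perfect and the invariants of every
global class in `H²(Γ_K, μ_n)` sum to zero.  Assembled from the primary reduction, the cyclotomic
killing, cyclic surjectivity and the cyclic reciprocity law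
(`poitouTate_sum_localTatePairing_eq_zero_of_isTotallyComplex_of_correction`) and the correction
above `p` (`exists_correction_trivial_above_p`).
[cite: CasselsFrohlichANT1967, Ch. VII §11] -/
theorem poitouTate_sum_localTatePairing_eq_zero_of_isTotallyComplex :
    poitouTate_sum_localTatePairing_eq_zero K :=
  poitouTate_sum_localTatePairing_eq_zero_of_isTotallyComplex_of_correction K
    fun p _ m y S hS => exists_correction_trivial_above_p K p m y S hS

end Literature.NumberTheory.GaloisCohomology

end
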